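import Summits.HodgeConjecture.HodgeConjecture.Theorems.R90S1RamifiedShellZeroFibre                  -- ★ (this seat) the two ramified shell-zero fibres; brings ★ `K2E3BranchBShellZeroFibres` (`heisZFibre_eq_zero_of_one_lt_valued`, place-generic)
import Summits.HodgeConjecture.HodgeConjecture.Theorems.R90S1SkewSphereMeasurable                   -- ★ (this seat) `measurableSet_setOf_valued_apply_eq_exp` (spheres of `R` are Borel)
import Mathlib.MeasureTheory.Integral.Bochner.Set
import HarnessLib

/-!
# R90 · S1 ∕ U4Keys leaf (U4f-χ₁-ram-one-d0B) — THE RAMIFIED SHELL-ZERO FIBRE FUNCTION IS AN INDICATOR, AND ITS `x`-INTEGRAL: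
# `x ↦ ∫_{y : |heisZ σ x y|_w = 1} E(heisZ σ x y) dμ⁻ = 𝟙_{|x_w| = 1}·χ₁(−½)·μ⁻{|y|_w < 1}`, hence `∫_R (fibre) dμR = μR.real{|x_w| = 1} • (χ₁(−½)·μ⁻.real{|y|_w < 1})`
# [Keys1984 §7 Thm (2) (d); Rogawski1990 §1.10, §12.2 (2); PAPER-Z3-DepthZeroRamified §1 (R90-C10-p05 (g0), r01-screened)]

Cell `hodgecm-mathlib`, SLAB R90-TF, section S1 «Ch. 12 local», crux H413 = `stmt-HodgeConjecture-24833` (lane `--supports … --as helper`), route HCCMUnconditional; prover seat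
`hodgecm-mathlib-R90-C10-p05` (g0); socket of record S1#3′ = K2E3 leaf (U4f-χ₁-ram-one) ⊇ U4Keys :155 (depth 0, Branch B).  THEOREMS ONLY (no definition ∕ instance ∕ notation ∕
named fact ∕ `sorry`); ★-only imports.  FRAME (v1 spellings): `R := LocalRing L v`, `σ := conjLocal L c v`, `R⁻ = skewPart σ`, chart `z = heisZ σ x y`; `v` non-split (`hw`), `w ∣ v`
RAMIFIED (`he`), `|2|_w = 1` (`h2w`, `[Invertible (2 : R)]`); the :155 letters `hdepth`, `hB`; `μ⁻ = μY` a measure on `R⁻`, `μR` a measure on `R`; `E r := χ₁(r̂)` if `r ∈ Rˣ` else `0`.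
THE POINT.  ★ `heisZFibre_eq_of_valued_eq_one_ram` (`|x|_w = 1`), ★ `heisZFibre_eq_zero_of_valued_lt_one_ram` (`|x|_w < 1`) and ★ place-generic `heisZFibre_eq_zero_of_one_lt_valued`
(`|x|_w > 1`) say that the shell-zero fibre, as a function of `x ∈ R`, is the INDICATOR of the unit sphere `{|x_w| = 1}` times the constant `χ₁(−½)·μ⁻.real{|y|_w < 1}`; its integral
against any measure `μR` on `R` is therefore `μR.real{|x_w| = 1} • (χ₁(−½)·μ⁻.real{|y|_w < 1})` (★ `measurableSet_setOf_valued_apply_eq_exp`, `integral_indicator_const`).  This is the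
`x`-side of the ramified shell-zero identity `h0`: once the Heisenberg-chart assembler identifies `∫_{Sh 0} F₀ dμ_N` with this iterated integral (product Haar `μR ⊗ μ⁻` pushed to `N`), `h0`
reads `χ₁(−½)·μR{|x_w| = 1}·μ⁻{|y|_w < 1} = χ₁(−2)·((q−1)∕q)·V` with `V = μR(𝒪)·μ⁻{|y|_w < 1}` and `μR{|x_w| = 1} = (1 − q⁻¹)·μR(𝒪)` (★ L-β0 ball ratios).
* **`heisZFibreZero_eq_indicator_ram`**, **`integral_heisZFibreZero_eq_ram`**.
HONEST LABEL.  HC_CM is proved only modulo the 7 printed citations (2 remaining named inputs: hLiu418 = `stmt-HodgeConjecture-24832`, h413 = `stmt-HodgeConjecture-24833`) until rung 0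
closes; count-neutral — this file does NOT pay the leaf; no printed citation is discharged.

## References
* [Keys1984] D. Keys, *Principal series representations of special unitary groups over local fields*, Compositio Math. 51 (1984), §4–§5, §7 Theorem (2) (d) p. 126.
* [Rogawski1990] J. D. Rogawski, *Automorphic Representations of Unitary Groups in Three Variables*, Ann. of Math. Stud. 123 (1990), §1.10 p. 9, §12.2 (2) p. 173.
-/

set_option autoImplicit false
-- the mandated namespace has the single-problem summit's repeated segment (`HodgeConjecture.HodgeConjecture`)
set_option linter.dupNamespace false

noncomputable section

open NumberField IsDedekindDomain MeasureTheory Measure Topology Set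
open scoped NNReal ENNReal
open Literature.NumberTheory Literature.NumberTheory.Automorphic Literature.NumberTheory.Automorphic.UnitaryGroup

namespace Summit.HodgeConjecture.HodgeConjecture.R90.S1

open Summit.HodgeConjecture.HodgeConjecture.Cruxes.H413
open Summit.HodgeConjecture.HodgeConjecture.Cruxes.H413.K2E3BranchBShellZeroFibres

variable (L : Type) [Field L] [NumberField L] [IsCMField L] (v : HeightOneSpectrum (𝓞 ↥(maximalRealSubfield L)))
  (w : PlacesOver L v) (hw : IsCMField.complexConj L • w.1 = w.1)

section Fibres

variable [MeasurableSpace (LocalRing L v)] [BorelSpace (LocalRing L v)]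
  (μY : Measure ↥(HeisRing.skewPart (conjLocal L (IsCMField.complexConj L) v)))

include hw in
open scoped Classical in
/-- **THE RAMIFIED SHELL-ZERO FIBRE FUNCTION IS AN INDICATOR**: at a tame ramified place in Branch B at depth zero, as a function of `x ∈ R`,
`∫_{y : |heisZ σ x y|_w = 1} E(heisZ σ x y) dμ⁻ = 𝟙_{{|x_w| = 1}}(x) · (χ₁(−½)·μ⁻.real{|y|_w < 1})` — ★ `heisZFibre_eq_of_valued_eq_one_ram` ∕ ★ `heisZFibre_eq_zero_of_valued_lt_one_ram` ∕ ★
`heisZFibre_eq_zero_of_one_lt_valued` by trichotomy of `|x_w|`. [cite: Keys1984, §7 Theorem (2) (d) p. 126] [cite: Rogawski1990, §1.10 p. 9, §12.2 (2) p. 173] -/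
theorem heisZFibreZero_eq_indicator_ram [Invertible (2 : LocalRing L v)] (he : v.asIdeal.ramificationIdx' w.1.asIdeal ≠ 1)
    (h2w : Valued.v (2 : w.1.adicCompletion L) = 1) (χ₁ : (LocalRing L v)ˣ →* ℂˣ)
    (hdepth : ∀ u : (LocalRing L v)ˣ, (∀ w' : PlacesOver L v, Valued.v (((u : LocalRing L v) w') - 1) < 1) → χ₁ u = 1)
    (hB : ∀ u : (LocalRing L v)ˣ, (∀ w' : PlacesOver L v, Valued.v ((u : LocalRing L v) w') = 1) →
      χ₁ (u * Units.map (conjLocal L (IsCMField.complexConj L) v : LocalRing L v →* LocalRing L v) u) = 1) :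
    (fun x : LocalRing L v => ∫ y in {y : ↥(HeisRing.skewPart (conjLocal L (IsCMField.complexConj L) v)) |
        Valued.v ((HeisRing.heisZ (conjLocal L (IsCMField.complexConj L) v) x (y : LocalRing L v)) w) = 1},
        (fun r : LocalRing L v => if h : IsUnit r then ((χ₁ h.unit : ℂˣ) : ℂ) else 0)
          (HeisRing.heisZ (conjLocal L (IsCMField.complexConj L) v) x (y : LocalRing L v)) ∂μY) =
      {x : LocalRing L v | Valued.v (x w) = 1}.indicator (fun _ =>
        ((χ₁ (-(unitOfInvertible (2 : LocalRing L v))⁻¹) : ℂˣ) : ℂ) *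
          (μY.real {y : ↥(HeisRing.skewPart (conjLocal L (IsCMField.complexConj L) v)) | Valued.v ((y : LocalRing L v) w) < 1} : ℂ)) := by
  funext x
  rcases lt_trichotomy (Valued.v (x w)) 1 with hx | hx | hx
  · rw [Set.indicator_of_notMem (by simp only [Set.mem_setOf_eq]; exact ne_of_lt hx)]
    exact heisZFibre_eq_zero_of_valued_lt_one_ram L v w hw μY he h2w χ₁ hx
  · rw [Set.indicator_of_mem (by simp only [Set.mem_setOf_eq]; exact hx)]
    exact heisZFibre_eq_of_valued_eq_one_ram L v w hw μY he h2w χ₁ hdepth hB hx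
  · rw [Set.indicator_of_notMem (by simp only [Set.mem_setOf_eq]; exact ne_of_gt hx)]
    exact heisZFibre_eq_zero_of_one_lt_valued L v w hw μY h2w χ₁ hx

include hw in
open scoped Classical in
/-- **THE `x`-INTEGRAL OF THE RAMIFIED SHELL-ZERO FIBRES**: for any measure `μR` on `R`,
`∫_R (∫_{y : |heisZ σ x y|_w = 1} E(heisZ σ x y) dμ⁻) dμR(x) = μR.real{|x_w| = 1} • (χ₁(−½)·μ⁻.real{|y|_w < 1})` — the indicator form and `integral_indicator_const` on the Borel unit sphere
(★ `measurableSet_setOf_valued_apply_eq_exp`).  The `x`-side of the ramified `h0`. [cite: Keys1984, §7 Theorem (2) (d) p. 126] [cite: Rogawski1990, §1.10 p. 9, §12.2 (2) p. 173] -/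
theorem integral_heisZFibreZero_eq_ram [Invertible (2 : LocalRing L v)] (he : v.asIdeal.ramificationIdx' w.1.asIdeal ≠ 1)
    (h2w : Valued.v (2 : w.1.adicCompletion L) = 1) (χ₁ : (LocalRing L v)ˣ →* ℂˣ)
    (hdepth : ∀ u : (LocalRing L v)ˣ, (∀ w' : PlacesOver L v, Valued.v (((u : LocalRing L v) w') - 1) < 1) → χ₁ u = 1)
    (hB : ∀ u : (LocalRing L v)ˣ, (∀ w' : PlacesOver L v, Valued.v ((u : LocalRing L v) w') = 1) →
      χ₁ (u * Units.map (conjLocal L (IsCMField.complexConj L) v : LocalRing L v →* LocalRing L v) u) = 1)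
    (μR : Measure (LocalRing L v)) :
    ∫ x, (∫ y in {y : ↥(HeisRing.skewPart (conjLocal L (IsCMField.complexConj L) v)) |
        Valued.v ((HeisRing.heisZ (conjLocal L (IsCMField.complexConj L) v) x (y : LocalRing L v)) w) = 1},
        (fun r : LocalRing L v => if h : IsUnit r then ((χ₁ h.unit : ℂˣ) : ℂ) else 0)
          (HeisRing.heisZ (conjLocal L (IsCMField.complexConj L) v) x (y : LocalRing L v)) ∂μY) ∂μR =
      μR.real {x : LocalRing L v | Valued.v (x w) = 1} •
        (((χ₁ (-(unitOfInvertible (2 : LocalRing L v))⁻¹) : ℂˣ) : ℂ) *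
          (μY.real {y : ↥(HeisRing.skewPart (conjLocal L (IsCMField.complexConj L) v)) | Valued.v ((y : LocalRing L v) w) < 1} : ℂ)) := by
  have hS : MeasurableSet {x : LocalRing L v | Valued.v (x w) = 1} := by
    have h := measurableSet_setOf_valued_apply_eq_exp L v w 0
    rwa [WithZero.exp_zero] at h
  have hfun := heisZFibreZero_eq_indicator_ram L v w hw μY he h2w χ₁ hdepth hB
  rw [show (fun x : LocalRing L v => ∫ y in {y : ↥(HeisRing.skewPart (conjLocal L (IsCMField.complexConj L) v)) |
        Valued.v ((HeisRing.heisZ (conjLocal L (IsCMField.complexConj L) v) x (y : LocalRing L v)) w) = 1},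
        (fun r : LocalRing L v => if h : IsUnit r then ((χ₁ h.unit : ℂˣ) : ℂ) else 0)
          (HeisRing.heisZ (conjLocal L (IsCMField.complexConj L) v) x (y : LocalRing L v)) ∂μY) = _ from hfun]
  exact integral_indicator_const _ hS

end Fibres

end Summit.HodgeConjecture.HodgeConjecture.R90.S1

end
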